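import Literature.RepresentationTheory.BorelWallach2000.UpqCasimirTensor        -- ★ `upqPBasis`, `upq_exists_kInLie_add_sum_upqPBasis`, `upq_lie_upqPBasis_mem_kInLie`, blocks of `𝔨`
import Literature.RepresentationTheory.BorelWallach2000.UpqMaximalCompactBlocks  -- ★ `upq_Ad_offDiag` (`Ad(K) 𝔭 ⊆ 𝔭`)
import Literature.NumberTheory.Automorphic.GKModulesOneParameter                -- ★ `IsGKModule.apply_mem_of_expK_stable` (`K`-stable ⇒ `𝔨`-stable)
import HarnessLib

/-!
# The `𝔭`-filtration `F_n = Σ_{k ≤ n} 𝔭^k · W₀` of a `(𝔤, K)`-module of `U(α, β)` generated by a `K`-stable subspace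

Topic `NumberTheory/Automorphic`; namespace `Literature.NumberTheory.Automorphic`.  Two DEFINITIONS with bodies (`upqPStep`, `upqPFiltration`) and
theorems; no named fact, no instance, no notation, no `sorry`.  Cell `hodgecm-mathlib`, F0∕P3, T1a arch line: node **N1** of the in-house road to the
letter V19 ★ `IrreducibleUnitaryKTypeGrowth` ([Varadarajan1989, §5.4 Thm. 19 = Harish-Chandra 1954], LEAD F0P3b-p01 (g2) 2026-08-31T17:59:55Z ∕ 18:10:45Z:
«N1 = the `𝔭`-filtration»).

THE MATHEMATICS ([Varadarajan1989, §5.3, proof of Thm. 10]; [WallachRRG1, §3.4 (the filtration `U_n(𝔤) W₀`)]; [KnappVogan1995, Prop. 10.?? / §IV (PBW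
filtration)]; classical).  Let `𝔤 = 𝔲(α, β) = 𝔨 ⊕ 𝔭` (`𝔨` block diagonal, `𝔭 = {X_B = [[0, B], [Bᴴ, 0]]}` with the real frame `(x_s)` = ★ `upqPBasis`), and
let `(V, ρK, ρ𝔤)` be `(𝔤, K)`-module data of `U(α, β)` (★ `GKModules`).  For a complex subspace `W₀ ≤ V` put
`F₀ := W₀`, `F_{n+1} := F_n + 𝔭 · F_n` (`𝔭 · U := Σ_s ρ𝔤(x_s) U`, `upqPStep`), so `F_n = Σ_{k ≤ n} 𝔭^k · W₀` (`upqPFiltration`).  Then: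
* §1 `[𝔨, 𝔭] ⊆ 𝔭` and `Ad(K) 𝔭 ⊆ 𝔭` as membership in the real span of the frame (`upq_lie_mem_span_upqPBasis_of_mem_kInLie`,
  `upq_Ad_upqPBasis_mem_span`), from the block shapes (★ `upq_coe_eq_fromBlocks_of_mem_kInLie`, ★ `upq_Ad_offDiag`);
* §2 `F` is monotone, `𝔭 · F_n ⊆ F_{n+1}`, and `ρ𝔤(X) F_n ⊆ F_{n+1}` for every `X` in the span of the frame;
* §3 if `W₀` is `𝔨`-stable then every `F_n` is `𝔨`-stable (`ρ𝔤(Y) ρ𝔤(x_s) u = ρ𝔤(x_s) ρ𝔤(Y) u + ρ𝔤([Y, x_s]) u`); if `W₀` is `K`-stable and the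
  `(𝔤, K)`-axioms hold then every `F_n` is `K`-stable (`ρK(k) ρ𝔤(x_s) u = ρ𝔤(Ad k x_s) ρK(k) u`) — and `K`-stable subspaces are `𝔨`-stable
  (★ `IsGKModule.apply_mem_of_expK_stable`);
* §4 EXHAUSTION: if `V` is irreducible and `W₀ ≠ 0` is `K`-stable then `⋃_n F_n = V` (`𝔤 = 𝔨 + Σ_s ℝ x_s`, ★ `upq_exists_kInLie_add_sum_upqPBasis`, so
  `⨆ F_n` is a non-zero `(𝔤, K)`-submodule);
* §5 WORDS: `F_n` is the span of the words `ρ𝔤(x_{s₁}) ⋯ ρ𝔤(x_{s_k}) w` (`k ≤ n`, `w ∈ W₀`); SYMMETRISATION: two words whose letters are a permutation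
  of each other differ by an element of `F_{n−1}` (`[𝔭, 𝔭] ⊆ 𝔨`, ★ `upq_lie_upqPBasis_mem_kInLie`, and §3) — i.e. the multiplication map
  `𝔭_ℂ^{⊗n} ⊗ W₀ → F_n ∕ F_{n−1}` is onto and factors through `Sym^n(𝔭_ℂ) ⊗ W₀`, stated on pure tensors without building the tensor objects;
  `K`-EQUIVARIANCE of words: `ρK(k) (ρ𝔤(X₁) ⋯ ρ𝔤(Xₙ) v) = ρ𝔤(Ad k X₁) ⋯ ρ𝔤(Ad k Xₙ) (ρK(k) v)`;
* §6 finite-dimensionality: `W₀` finite-dimensional ⇒ every `F_n` finite-dimensional.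
These are the inputs of the next nodes (N2: the Casimir `Ω = Ω_𝔭 + Ω_𝔨` acts by a scalar, ★ `upqCasimirOp_eq_algebraMap_of_isIrreducibleGK`, so the
symbol `q` of `Ω_𝔭` kills `F_n ∕ F_{n−1}` two steps up; N3–N4: `K`-types of `Sym(𝔭_ℂ) ∕ (q)`).

HONEST LABEL: kernel theorems about abstract `(𝔤, K)`-modules of `U(α, β)`; nothing printed about HC_CM is discharged here.  HC_CM is proved only modulo
the 2 remaining named inputs (hLiu418, h413) until rung 0 closes.

## References
* V. S. Varadarajan, *An Introduction to Harmonic Analysis on Semisimple Lie Groups* (1989), §5.3 (proof of Thm. 10). [Varadarajan1989]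
* N. R. Wallach, *Real Reductive Groups I* (1988), §3.3–§3.4. [WallachRRG1]
* A. Borel, N. Wallach, *Continuous Cohomology, Discrete Subgroups, and Representations of Reductive Groups*, 2nd ed. (2000), II §1.1. [BorelWallach2000]
-/

-- Mathlib idiom (as in ★ `GKModules` and every `(𝔤, K)` file of the tree): the commutator bracket on `Module.End ℂ V` and on matrices, needed to
-- MENTION `ρ𝔤 : (uFormGroup α β).lie →ₗ⁅ℝ⁆ Module.End ℂ V` (`LieRing.ofAssociativeRing` is a `def` in Mathlib, not a global instance).
attribute [local instance 100] LieRing.ofAssociativeRing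

set_option autoImplicit false

open scoped MatrixGroups Matrix

noncomputable section

namespace Literature.NumberTheory.Automorphic

open Literature.RepresentationTheory Literature.RepresentationTheory.BorelWallach2000 Literature.RepresentationTheory.KonnoKonno2007

variable {α β : Type} [Fintype α] [DecidableEq α] [Fintype β] [DecidableEq β]

/-! ## §1 `[𝔨, 𝔭] ⊆ 𝔭` and `Ad(K) 𝔭 ⊆ 𝔭` in the frame `(x_s)` -/

section Frame

/-- An element of `𝔲(α, β)` whose two DIAGONAL blocks vanish lies in the real span of the `𝔭`-frame `(x_s)` (write `X = k + Σ c_s x_s` with `k ∈ 𝔨`,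
★ `upq_exists_kInLie_add_sum_upqPBasis`; `k` is block diagonal AND off-diagonal, hence `0`). [cite: BorelWallach2000, II §1.1 (3)] -/
theorem upq_mem_span_upqPBasis_of_toBlocks_eq_zero (X : (uFormGroup α β).lie)
    (h11 : (X : Matrix (α ⊕ β) (α ⊕ β) ℂ).toBlocks₁₁ = 0) (h22 : (X : Matrix (α ⊕ β) (α ⊕ β) ℂ).toBlocks₂₂ = 0) :
    X ∈ Submodule.span ℝ (Set.range (upqPBasis : (α × β) × Fin 2 → (uFormGroup α β).lie)) := by
  obtain ⟨k, hk, c, hX⟩ := upq_exists_kInLie_add_sum_upqPBasis X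
  -- the sum `Σ c_s x_s` is off-diagonal
  have hP11 : ((∑ s, c s • upqPBasis s : (uFormGroup α β).lie) : Matrix (α ⊕ β) (α ⊕ β) ℂ).toBlocks₁₁ = 0 := by
    rw [AddSubmonoidClass.coe_finsetSum]
    simp only [upqPBasis, upq_real_smul_upqUnit, coe_upqUnit]
    ext i j
    simp [Matrix.toBlocks₁₁, Matrix.sum_apply, Matrix.fromBlocks_apply₁₁]
  have hP22 : ((∑ s, c s • upqPBasis s : (uFormGroup α β).lie) : Matrix (α ⊕ β) (α ⊕ β) ℂ).toBlocks₂₂ = 0 := by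
    rw [AddSubmonoidClass.coe_finsetSum]
    simp only [upqPBasis, upq_real_smul_upqUnit, coe_upqUnit]
    ext i j
    simp [Matrix.toBlocks₂₂, Matrix.sum_apply, Matrix.fromBlocks_apply₂₂]
  -- hence `k = X - Σ c_s x_s` is both block diagonal and off-diagonal: `k = 0`
  have hk0 : k = 0 := by
    have hk12 : (k : Matrix (α ⊕ β) (α ⊕ β) ℂ).toBlocks₁₂ = 0 := (upq_mem_kInLie_iff_blocks k).1 hk
    have hk21 : (k : Matrix (α ⊕ β) (α ⊕ β) ℂ).toBlocks₂₁ = 0 := by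
      rw [(upq_lie_blocks k).2.2, hk12, Matrix.conjTranspose_zero]
    have hkX : (k : Matrix (α ⊕ β) (α ⊕ β) ℂ) =
        (X : Matrix (α ⊕ β) (α ⊕ β) ℂ) - ((∑ s, c s • upqPBasis s : (uFormGroup α β).lie) : Matrix (α ⊕ β) (α ⊕ β) ℂ) := by
      rw [hX]; push_cast; rw [add_sub_cancel_right]
    have hk11 : (k : Matrix (α ⊕ β) (α ⊕ β) ℂ).toBlocks₁₁ = 0 := by
      have := congrArg Matrix.toBlocks₁₁ hkX
      rw [this]
      change ((X : Matrix (α ⊕ β) (α ⊕ β) ℂ) - ((∑ s, c s • upqPBasis s : (uFormGroup α β).lie) : Matrix _ _ ℂ)).toBlocks₁₁ = 0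
      ext i j
      simp only [Matrix.toBlocks₁₁, Matrix.sub_apply, Matrix.of_apply, Matrix.zero_apply]
      have a := congrFun (congrFun h11 i) j
      have b := congrFun (congrFun hP11 i) j
      simp only [Matrix.toBlocks₁₁, Matrix.of_apply, Matrix.zero_apply] at a b
      rw [a, b, sub_zero]
    have hk22 : (k : Matrix (α ⊕ β) (α ⊕ β) ℂ).toBlocks₂₂ = 0 := by
      have := congrArg Matrix.toBlocks₂₂ hkX
      rw [this]
      change ((X : Matrix (α ⊕ β) (α ⊕ β) ℂ) - ((∑ s, c s • upqPBasis s : (uFormGroup α β).lie) : Matrix _ _ ℂ)).toBlocks₂₂ = 0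
      ext i j
      simp only [Matrix.toBlocks₂₂, Matrix.sub_apply, Matrix.of_apply, Matrix.zero_apply]
      have a := congrFun (congrFun h22 i) j
      have b := congrFun (congrFun hP22 i) j
      simp only [Matrix.toBlocks₂₂, Matrix.of_apply, Matrix.zero_apply] at a b
      rw [a, b, sub_zero]
    apply Subtype.ext
    rw [← Matrix.fromBlocks_toBlocks (k : Matrix (α ⊕ β) (α ⊕ β) ℂ), hk11, hk12, hk21, hk22, Matrix.fromBlocks_zero]
    rfl
  rw [hX, hk0, zero_add]
  exact Submodule.sum_mem _ fun s _ => Submodule.smul_mem _ _ (Submodule.subset_span ⟨s, rfl⟩)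

/-- The hermitian generator `X_B = [[0, B], [Bᴴ, 0]]` lies in the real span of the frame `(x_s)`. [cite: BorelWallach2000, II §1.1 (3)] -/
theorem upq_offDiag_mem_span_upqPBasis (B : Matrix α β ℂ) :
    (⟨Matrix.fromBlocks 0 B Bᴴ 0, upq_offDiag_mem_lie B⟩ : (uFormGroup α β).lie) ∈
      Submodule.span ℝ (Set.range (upqPBasis : (α × β) × Fin 2 → (uFormGroup α β).lie)) :=
  upq_mem_span_upqPBasis_of_toBlocks_eq_zero _ (by simp) (by simp)

/-- **`[𝔨, 𝔭] ⊆ 𝔭`**: for `Y ∈ 𝔨` (block diagonal) the bracket `[Y, x_s]` has vanishing diagonal blocks, hence lies in the span of the frame.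
[cite: BorelWallach2000, II §1.1 (4)] -/
theorem upq_lie_mem_span_upqPBasis_of_mem_kInLie (Y : (uFormGroup α β).lie) (hY : Y ∈ (uFormGroup α β).kInLie)
    (s : (α × β) × Fin 2) :
    ⁅Y, upqPBasis s⁆ ∈ Submodule.span ℝ (Set.range (upqPBasis : (α × β) × Fin 2 → (uFormGroup α β).lie)) := by
  have hYb := upq_coe_eq_fromBlocks_of_mem_kInLie Y hY
  refine upq_mem_span_upqPBasis_of_toBlocks_eq_zero _ ?_ ?_
  · rw [LieSubalgebra.coe_bracket, Ring.lie_def, hYb, upqPBasis, coe_upqUnit, Matrix.fromBlocks_multiply,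
      Matrix.fromBlocks_multiply, sub_eq_add_neg, Matrix.fromBlocks_neg, Matrix.fromBlocks_add, Matrix.toBlocks_fromBlocks₁₁]
    simp
  · rw [LieSubalgebra.coe_bracket, Ring.lie_def, hYb, upqPBasis, coe_upqUnit, Matrix.fromBlocks_multiply,
      Matrix.fromBlocks_multiply, sub_eq_add_neg, Matrix.fromBlocks_neg, Matrix.fromBlocks_add, Matrix.toBlocks_fromBlocks₂₂]
    simp

/-- **`Ad(K) 𝔭 ⊆ 𝔭`**: `Ad(k) x_s` (`k ∈ K = U(α) × U(β)`) is again a hermitian generator `X_{k₁ B k₂ᴴ}` (★ `upq_Ad_offDiag`), hence in the span of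
the frame. [cite: BorelWallach2000, VI 4.8 (3)] -/
theorem upq_Ad_upqPBasis_mem_span (k : (uFormGroup α β).maximalCompact) (s : (α × β) × Fin 2) :
    (uFormGroup α β).Ad (Subgroup.inclusion (uFormGroup α β).maximalCompact_le_carrier k) (upqPBasis s) ∈
      Submodule.span ℝ (Set.range (upqPBasis : (α × β) × Fin 2 → (uFormGroup α β).lie)) := by
  have h : (upqPBasis s : (uFormGroup α β).lie) =
      ⟨Matrix.fromBlocks 0 (Matrix.single s.1.1 s.1.2 (upqPCoeff s.2)) (Matrix.single s.1.1 s.1.2 (upqPCoeff s.2))ᴴ 0,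
        upq_offDiag_mem_lie _⟩ := Subtype.ext rfl
  rw [h, upq_Ad_offDiag]
  exact upq_offDiag_mem_span_upqPBasis _

end Frame

/-! ## §2 The step `𝔭 · U` and the filtration `F_n` -/

section Filtration

variable {V : Type*} [AddCommGroup V] [Module ℂ V]
  (ρK : Representation ℂ (uFormGroup α β).maximalCompact V) (ρ𝔤 : (uFormGroup α β).lie →ₗ⁅ℝ⁆ Module.End ℂ V)

/-- **`𝔭 · U`** — the complex subspace `Σ_s ρ𝔤(x_s) U` spanned by the images of `U` under the `𝔭`-frame `(x_s)` (★ `upqPBasis`); since `(x_s)` is a real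
basis of `𝔭` and `U` is a complex subspace, this is the span of `ρ𝔤(𝔭) U`. [cite: WallachRRG1, §3.4] [cite: Varadarajan1989, §5.3 (proof of Thm. 10)] -/
def upqPStep (U : Submodule ℂ V) : Submodule ℂ V :=
  ⨆ s : (α × β) × Fin 2, U.map (ρ𝔤 (upqPBasis s))

/-- **The `𝔭`-filtration** `F₀ = W₀`, `F_{n+1} = F_n + 𝔭 · F_n`, i.e. `F_n = Σ_{k ≤ n} 𝔭^k · W₀`.
[cite: WallachRRG1, §3.4] [cite: Varadarajan1989, §5.3 (proof of Thm. 10)] -/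
def upqPFiltration (W₀ : Submodule ℂ V) : ℕ → Submodule ℂ V
  | 0 => W₀
  | n + 1 => upqPFiltration W₀ n ⊔ upqPStep ρ𝔤 (upqPFiltration W₀ n)

variable {ρ𝔤}

/-- `ρ𝔤(x_s) u ∈ 𝔭 · U` for `u ∈ U`. [cite: WallachRRG1, §3.4] -/
theorem apply_upqPBasis_mem_upqPStep {U : Submodule ℂ V} (s : (α × β) × Fin 2) {u : V} (hu : u ∈ U) :
    ρ𝔤 (upqPBasis s) u ∈ upqPStep ρ𝔤 U :=
  Submodule.mem_iSup_of_mem s (Submodule.mem_map_of_mem hu)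

/-- `ρ𝔤(X) u ∈ 𝔭 · U` for `u ∈ U` and `X` in the real span of the frame (`ρ𝔤` is `ℝ`-linear, `𝔭 · U` is a complex subspace).
[cite: WallachRRG1, §3.4] -/
theorem apply_mem_upqPStep_of_mem_span {U : Submodule ℂ V} {X : (uFormGroup α β).lie}
    (hX : X ∈ Submodule.span ℝ (Set.range (upqPBasis : (α × β) × Fin 2 → (uFormGroup α β).lie))) {u : V} (hu : u ∈ U) :
    ρ𝔤 X u ∈ upqPStep ρ𝔤 U := by
  induction hX using Submodule.span_induction with
  | mem _ h =>
    obtain ⟨s, rfl⟩ := h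
    exact apply_upqPBasis_mem_upqPStep s hu
  | zero => rw [map_zero, LinearMap.zero_apply]; exact Submodule.zero_mem _
  | add X Y _ _ hX hY =>
    rw [map_add, LinearMap.add_apply]
    exact Submodule.add_mem _ hX hY
  | smul c X _ hX =>
    rw [map_smul, LinearMap.smul_apply, ← Complex.coe_smul]
    exact Submodule.smul_mem _ _ hX

/-- `𝔭 · U` is monotone in `U`. [cite: WallachRRG1, §3.4] -/
theorem upqPStep_mono {U U' : Submodule ℂ V} (h : U ≤ U') : upqPStep ρ𝔤 U ≤ upqPStep ρ𝔤 U' :=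
  iSup_mono fun _ => Submodule.map_mono h

/-- Mapping principle for `𝔭 · U`: a linear map sending every generator `ρ𝔤(x_s) u` (`u ∈ U`) into `S` sends `𝔭 · U` into `S`.
[cite: WallachRRG1, §3.4] -/
theorem upqPStep_le_comap {U S : Submodule ℂ V} (T : V →ₗ[ℂ] V)
    (h : ∀ (s : (α × β) × Fin 2), ∀ u ∈ U, T (ρ𝔤 (upqPBasis s) u) ∈ S) : upqPStep ρ𝔤 U ≤ S.comap T :=
  iSup_le fun s => Submodule.map_le_iff_le_comap.mpr fun u hu => h s u hu

variable (ρ𝔤) in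
/-- `F₀ = W₀`. [cite: WallachRRG1, §3.4] -/
@[simp] theorem upqPFiltration_zero (W₀ : Submodule ℂ V) : upqPFiltration ρ𝔤 W₀ 0 = W₀ := rfl

variable (ρ𝔤) in
/-- `F_{n+1} = F_n + 𝔭 · F_n`. [cite: WallachRRG1, §3.4] -/
theorem upqPFiltration_succ (W₀ : Submodule ℂ V) (n : ℕ) :
    upqPFiltration ρ𝔤 W₀ (n + 1) = upqPFiltration ρ𝔤 W₀ n ⊔ upqPStep ρ𝔤 (upqPFiltration ρ𝔤 W₀ n) := rfl

variable (ρ𝔤) in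
/-- `F_n ≤ F_{n+1}`. [cite: WallachRRG1, §3.4] -/
theorem upqPFiltration_le_succ (W₀ : Submodule ℂ V) (n : ℕ) : upqPFiltration ρ𝔤 W₀ n ≤ upqPFiltration ρ𝔤 W₀ (n + 1) := by
  rw [upqPFiltration_succ]; exact le_sup_left

variable (ρ𝔤) in
/-- The filtration is monotone. [cite: WallachRRG1, §3.4] -/
theorem monotone_upqPFiltration (W₀ : Submodule ℂ V) : Monotone (upqPFiltration ρ𝔤 W₀) :=
  monotone_nat_of_le_succ (upqPFiltration_le_succ ρ𝔤 W₀)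

variable (ρ𝔤) in
/-- `W₀ ≤ F_n`. [cite: WallachRRG1, §3.4] -/
theorem le_upqPFiltration (W₀ : Submodule ℂ V) (n : ℕ) : W₀ ≤ upqPFiltration ρ𝔤 W₀ n :=
  monotone_upqPFiltration ρ𝔤 W₀ (Nat.zero_le n)

variable (ρ𝔤) in
/-- `𝔭 · F_n ≤ F_{n+1}`. [cite: WallachRRG1, §3.4] -/
theorem upqPStep_upqPFiltration_le (W₀ : Submodule ℂ V) (n : ℕ) :
    upqPStep ρ𝔤 (upqPFiltration ρ𝔤 W₀ n) ≤ upqPFiltration ρ𝔤 W₀ (n + 1) := by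
  rw [upqPFiltration_succ]; exact le_sup_right

/-- `ρ𝔤(x_s) F_n ⊆ F_{n+1}`. [cite: WallachRRG1, §3.4] -/
theorem apply_upqPBasis_mem_upqPFiltration_succ {W₀ : Submodule ℂ V} {n : ℕ} (s : (α × β) × Fin 2) {u : V}
    (hu : u ∈ upqPFiltration ρ𝔤 W₀ n) : ρ𝔤 (upqPBasis s) u ∈ upqPFiltration ρ𝔤 W₀ (n + 1) :=
  upqPStep_upqPFiltration_le ρ𝔤 W₀ n (apply_upqPBasis_mem_upqPStep s hu)

/-- `ρ𝔤(X) F_n ⊆ F_{n+1}` for `X` in the span of the frame (all of `𝔭`). [cite: WallachRRG1, §3.4] -/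
theorem apply_mem_upqPFiltration_succ_of_mem_span {W₀ : Submodule ℂ V} {n : ℕ} {X : (uFormGroup α β).lie}
    (hX : X ∈ Submodule.span ℝ (Set.range (upqPBasis : (α × β) × Fin 2 → (uFormGroup α β).lie))) {u : V}
    (hu : u ∈ upqPFiltration ρ𝔤 W₀ n) : ρ𝔤 X u ∈ upqPFiltration ρ𝔤 W₀ (n + 1) :=
  upqPStep_upqPFiltration_le ρ𝔤 W₀ n (apply_mem_upqPStep_of_mem_span hX hu)

/-! ## §3 `𝔨`-stability and `K`-stability -/

/-- **`𝔨`-stability propagates one step**: if `U` is `𝔨`-stable then `ρ𝔤(Y) (𝔭 · U) ⊆ 𝔭 · U` for `Y ∈ 𝔨`, because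
`ρ𝔤(Y) ρ𝔤(x_s) u = ρ𝔤(x_s) ρ𝔤(Y) u + ρ𝔤([Y, x_s]) u` and `[Y, x_s] ∈ 𝔭`. [cite: WallachRRG1, §3.4] [cite: BorelWallach2000, II §1.1 (4)] -/
theorem apply_mem_upqPStep_of_mem_kInLie {U : Submodule ℂ V} (hU : ∀ Y ∈ (uFormGroup α β).kInLie, ∀ u ∈ U, ρ𝔤 Y u ∈ U)
    {Y : (uFormGroup α β).lie} (hY : Y ∈ (uFormGroup α β).kInLie) {x : V} (hx : x ∈ upqPStep ρ𝔤 U) :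
    ρ𝔤 Y x ∈ upqPStep ρ𝔤 U := by
  refine upqPStep_le_comap (S := upqPStep ρ𝔤 U) (ρ𝔤 Y) (fun s u hu => ?_) hx
  have hcomm : ρ𝔤 Y (ρ𝔤 (upqPBasis s) u) = ρ𝔤 (upqPBasis s) (ρ𝔤 Y u) + ρ𝔤 ⁅Y, upqPBasis s⁆ u := by
    rw [LieHom.map_lie, LieRing.of_associative_ring_bracket, LinearMap.sub_apply, Module.End.mul_apply,
      Module.End.mul_apply, add_sub_cancel]
  rw [hcomm]
  exact Submodule.add_mem _ (apply_upqPBasis_mem_upqPStep s (hU Y hY u hu))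
    (apply_mem_upqPStep_of_mem_span (upq_lie_mem_span_upqPBasis_of_mem_kInLie Y hY s) hu)

/-- **Every `F_n` is `𝔨`-stable when `W₀` is.** [cite: WallachRRG1, §3.4] -/
theorem apply_mem_upqPFiltration_of_mem_kInLie {W₀ : Submodule ℂ V} (hW₀ : ∀ Y ∈ (uFormGroup α β).kInLie, ∀ w ∈ W₀, ρ𝔤 Y w ∈ W₀)
    (n : ℕ) {Y : (uFormGroup α β).lie} (hY : Y ∈ (uFormGroup α β).kInLie) {x : V} (hx : x ∈ upqPFiltration ρ𝔤 W₀ n) :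
    ρ𝔤 Y x ∈ upqPFiltration ρ𝔤 W₀ n := by
  induction n generalizing Y x with
  | zero => exact hW₀ Y hY x hx
  | succ n ih =>
    rw [upqPFiltration_succ] at hx ⊢
    obtain ⟨y, hy, z, hz, rfl⟩ := Submodule.mem_sup.mp hx
    rw [map_add]
    exact Submodule.add_mem_sup (ih hY hy) (apply_mem_upqPStep_of_mem_kInLie (fun Y hY u hu => ih hY hu) hY hz)

/-- **`K`-stability propagates one step** under the `(𝔤, K)`-axiom `Ad`-compatibility: `ρK(k) ρ𝔤(x_s) u = ρ𝔤(Ad k x_s) ρK(k) u` and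
`Ad k x_s ∈ 𝔭`. [cite: WallachRRG1, §3.3.1, §3.4] [cite: BorelWallach2000, VI 4.8 (3)] -/
theorem apply_mem_upqPStep_of_K_stable (hV : IsGKModule (uFormGroup α β) ρK ρ𝔤) {U : Submodule ℂ V}
    (hU : ∀ (k : (uFormGroup α β).maximalCompact), ∀ u ∈ U, ρK k u ∈ U) (k : (uFormGroup α β).maximalCompact) {x : V}
    (hx : x ∈ upqPStep ρ𝔤 U) : ρK k x ∈ upqPStep ρ𝔤 U := by
  refine upqPStep_le_comap (S := upqPStep ρ𝔤 U) (ρK k) (fun s u hu => ?_) hx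
  have h := LinearMap.congr_fun (hV.ad_compat k (upqPBasis s)) (ρK k u)
  simp only [LinearMap.coe_comp, Function.comp_apply] at h
  rw [← Module.End.mul_apply (ρK k⁻¹), ← map_mul, inv_mul_cancel, map_one, Module.End.one_apply] at h
  rw [h]
  exact apply_mem_upqPStep_of_mem_span (upq_Ad_upqPBasis_mem_span k s) (hU k u hu)

/-- **Every `F_n` is `K`-stable when `W₀` is** (and the `(𝔤, K)`-axioms hold). [cite: WallachRRG1, §3.3.1, §3.4] -/
theorem apply_mem_upqPFiltration_of_K_stable (hV : IsGKModule (uFormGroup α β) ρK ρ𝔤) {W₀ : Submodule ℂ V}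
    (hW₀ : ∀ (k : (uFormGroup α β).maximalCompact), ∀ w ∈ W₀, ρK k w ∈ W₀) (n : ℕ) (k : (uFormGroup α β).maximalCompact) {x : V}
    (hx : x ∈ upqPFiltration ρ𝔤 W₀ n) : ρK k x ∈ upqPFiltration ρ𝔤 W₀ n := by
  induction n generalizing k x with
  | zero => exact hW₀ k x hx
  | succ n ih =>
    rw [upqPFiltration_succ] at hx ⊢
    obtain ⟨y, hy, z, hz, rfl⟩ := Submodule.mem_sup.mp hx
    rw [map_add]
    exact Submodule.add_mem_sup (ih k hy) (apply_mem_upqPStep_of_K_stable ρK hV (fun k u hu => ih k hu) k hz)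

/-- **A `K`-stable subspace of a `(𝔤, K)`-module is `𝔨`-stable** (★ `IsGKModule.apply_mem_of_expK_stable`: differentiate `t ↦ ρK(exp tY) u ∈ U` weakly),
phrased with `𝔨 ≤ 𝔤` as ★ `RealMatrixGroup.kInLie`. [cite: WallachRRG1, §3.3.1] -/
theorem apply_mem_of_K_stable_of_mem_kInLie (hV : IsGKModule (uFormGroup α β) ρK ρ𝔤) {U : Submodule ℂ V}
    (hU : ∀ (k : (uFormGroup α β).maximalCompact), ∀ u ∈ U, ρK k u ∈ U) {Y : (uFormGroup α β).lie}
    (hY : Y ∈ (uFormGroup α β).kInLie) {u : V} (hu : u ∈ U) : ρ𝔤 Y u ∈ U := by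
  obtain ⟨X, rfl⟩ := hY
  exact hV.apply_mem_of_expK_stable X (fun t u hu => hU _ u hu) hu

/-- Every `F_n` is `𝔨`-stable when `W₀` is `K`-stable (and the `(𝔤, K)`-axioms hold). [cite: WallachRRG1, §3.3.1, §3.4] -/
theorem apply_mem_upqPFiltration_of_K_stable_of_mem_kInLie (hV : IsGKModule (uFormGroup α β) ρK ρ𝔤) {W₀ : Submodule ℂ V}
    (hW₀ : ∀ (k : (uFormGroup α β).maximalCompact), ∀ w ∈ W₀, ρK k w ∈ W₀) (n : ℕ) {Y : (uFormGroup α β).lie}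
    (hY : Y ∈ (uFormGroup α β).kInLie) {x : V} (hx : x ∈ upqPFiltration ρ𝔤 W₀ n) : ρ𝔤 Y x ∈ upqPFiltration ρ𝔤 W₀ n :=
  apply_mem_upqPFiltration_of_mem_kInLie (fun _ hY _ hw => apply_mem_of_K_stable_of_mem_kInLie ρK hV hW₀ hY hw) n hY hx

/-! ## §4 Exhaustion: `⋃_n F_n = V` for `V` irreducible -/

/-- Membership in `⨆_n F_n` is membership in some `F_n` (the filtration is monotone). [cite: WallachRRG1, §3.4] -/
theorem mem_iSup_upqPFiltration_iff {W₀ : Submodule ℂ V} {x : V} :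
    x ∈ ⨆ n, upqPFiltration ρ𝔤 W₀ n ↔ ∃ n, x ∈ upqPFiltration ρ𝔤 W₀ n :=
  Submodule.mem_iSup_of_directed _ (monotone_upqPFiltration ρ𝔤 W₀).directed_le

/-- **`⨆_n F_n` is a `(𝔤, K)`-submodule** when `W₀` is `K`-stable: it is `K`-stable and `𝔨`-stable (§3) and `𝔭`-stable (§2), and `𝔤 = 𝔨 + Σ_s ℝ x_s`
(★ `upq_exists_kInLie_add_sum_upqPBasis`). [cite: WallachRRG1, §3.3.1, §3.4] [cite: BorelWallach2000, II §1.1 (3)] -/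
theorem isGKSubmodule_iSup_upqPFiltration (hV : IsGKModule (uFormGroup α β) ρK ρ𝔤) {W₀ : Submodule ℂ V}
    (hW₀ : ∀ (k : (uFormGroup α β).maximalCompact), ∀ w ∈ W₀, ρK k w ∈ W₀) :
    IsGKSubmodule ρK ρ𝔤 (⨆ n, upqPFiltration ρ𝔤 W₀ n) := by
  refine ⟨fun k x hx => ?_, fun X x hx => ?_⟩
  · obtain ⟨n, hn⟩ := mem_iSup_upqPFiltration_iff.mp hx
    exact mem_iSup_upqPFiltration_iff.mpr ⟨n, apply_mem_upqPFiltration_of_K_stable ρK hV hW₀ n k hn⟩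
  · obtain ⟨n, hn⟩ := mem_iSup_upqPFiltration_iff.mp hx
    obtain ⟨Y, hY, c, rfl⟩ := upq_exists_kInLie_add_sum_upqPBasis X
    rw [map_add, LinearMap.add_apply]
    refine Submodule.add_mem _ (mem_iSup_upqPFiltration_iff.mpr ⟨n, ?_⟩) (mem_iSup_upqPFiltration_iff.mpr ⟨n + 1, ?_⟩)
    · exact apply_mem_upqPFiltration_of_K_stable_of_mem_kInLie ρK hV hW₀ n hY hn
    · exact apply_mem_upqPFiltration_succ_of_mem_span
        (Submodule.sum_mem _ fun s _ => Submodule.smul_mem _ _ (Submodule.subset_span ⟨s, rfl⟩)) hn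

/-- **EXHAUSTION**: for an irreducible `(𝔤, K)`-module `V` of `U(α, β)` and a non-zero `K`-stable subspace `W₀`, `⨆_n F_n = V` — every vector lies in some
`F_n = Σ_{k ≤ n} 𝔭^k · W₀`. [cite: Varadarajan1989, §5.3 (proof of Thm. 10)] [cite: WallachRRG1, §3.4] -/
theorem iSup_upqPFiltration_eq_top (hV : IsGKModule (uFormGroup α β) ρK ρ𝔤) (hirr : IsIrreducibleGK ρK ρ𝔤) {W₀ : Submodule ℂ V}
    (hW₀ : ∀ (k : (uFormGroup α β).maximalCompact), ∀ w ∈ W₀, ρK k w ∈ W₀) (hW₀ne : W₀ ≠ ⊥) :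
    ⨆ n, upqPFiltration ρ𝔤 W₀ n = ⊤ := by
  rcases hirr.eq_bot_or_eq_top (isGKSubmodule_iSup_upqPFiltration ρK hV hW₀) with h | h
  · exact absurd (le_bot_iff.mp (h ▸ (le_iSup (upqPFiltration ρ𝔤 W₀) 0 : W₀ ≤ _))) hW₀ne
  · exact h

/-- Exhaustion, pointwise: every `v ∈ V` lies in some `F_n`. [cite: Varadarajan1989, §5.3 (proof of Thm. 10)] -/
theorem exists_mem_upqPFiltration (hV : IsGKModule (uFormGroup α β) ρK ρ𝔤) (hirr : IsIrreducibleGK ρK ρ𝔤) {W₀ : Submodule ℂ V}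
    (hW₀ : ∀ (k : (uFormGroup α β).maximalCompact), ∀ w ∈ W₀, ρK k w ∈ W₀) (hW₀ne : W₀ ≠ ⊥) (v : V) :
    ∃ n, v ∈ upqPFiltration ρ𝔤 W₀ n :=
  mem_iSup_upqPFiltration_iff.mp (by rw [iSup_upqPFiltration_eq_top ρK hV hirr hW₀ hW₀ne]; exact Submodule.mem_top)

/-! ## §5 Words in the frame: spanning, symmetrisation, `K`-equivariance -/

/-- A word `ρ𝔤(x_{s₁}) ⋯ ρ𝔤(x_{s_k})` of length `k` maps `F_n` into `F_{n+k}`. [cite: WallachRRG1, §3.4] -/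
theorem wordProd_apply_mem_upqPFiltration {W₀ : Submodule ℂ V} (l : List ((α × β) × Fin 2)) {n : ℕ} {u : V}
    (hu : u ∈ upqPFiltration ρ𝔤 W₀ n) :
    (l.map fun s => ρ𝔤 (upqPBasis s)).prod u ∈ upqPFiltration ρ𝔤 W₀ (n + l.length) := by
  induction l with
  | nil => simpa using hu
  | cons s l ih =>
    simp only [List.map_cons, List.prod_cons, Module.End.mul_apply, List.length_cons]
    rw [← add_assoc]
    exact apply_upqPBasis_mem_upqPFiltration_succ s ih

/-- In particular a word of length `k` applied to `w ∈ W₀` lies in `F_k`. [cite: WallachRRG1, §3.4] -/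
theorem wordProd_apply_mem_upqPFiltration_length {W₀ : Submodule ℂ V} (l : List ((α × β) × Fin 2)) {w : V} (hw : w ∈ W₀) :
    (l.map fun s => ρ𝔤 (upqPBasis s)).prod w ∈ upqPFiltration ρ𝔤 W₀ l.length := by
  simpa using wordProd_apply_mem_upqPFiltration l (n := 0) (by simpa using hw)

variable (ρ𝔤) in
/-- **`F_n` IS THE SPAN OF THE WORDS OF LENGTH `≤ n`** applied to `W₀` (the multiplication map `⊕_{k ≤ n} 𝔭^{⊗k} ⊗ W₀ → F_n` is onto).
[cite: Varadarajan1989, §5.3 (proof of Thm. 10)] [cite: WallachRRG1, §3.4] -/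
theorem upqPFiltration_eq_span_words (W₀ : Submodule ℂ V) (n : ℕ) :
    upqPFiltration ρ𝔤 W₀ n =
      Submodule.span ℂ {v | ∃ l : List ((α × β) × Fin 2), l.length ≤ n ∧ ∃ w ∈ W₀, v = (l.map fun s => ρ𝔤 (upqPBasis s)).prod w} := by
  induction n with
  | zero =>
    apply le_antisymm
    · intro w hw
      exact Submodule.subset_span ⟨[], le_rfl, w, hw, by simp⟩
    · rw [Submodule.span_le]
      rintro _ ⟨l, hl, w, hw, rfl⟩
      obtain rfl : l = [] := List.eq_nil_of_length_eq_zero (Nat.le_zero.mp hl)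
      simpa using hw
  | succ n ih =>
    apply le_antisymm
    · rw [upqPFiltration_succ, sup_le_iff]
      refine ⟨ih.le.trans (Submodule.span_mono fun v ⟨l, hl, w, hw, hv⟩ => ⟨l, hl.trans n.le_succ, w, hw, hv⟩), ?_⟩
      refine iSup_le fun s => Submodule.map_le_iff_le_comap.mpr ?_
      rw [ih, Submodule.span_le]
      rintro _ ⟨l, hl, w, hw, rfl⟩
      refine Submodule.subset_span ⟨s :: l, by simpa using hl, w, hw, ?_⟩
      simp [Module.End.mul_apply]
    · rw [Submodule.span_le]
      rintro _ ⟨l, hl, w, hw, rfl⟩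
      rcases Nat.lt_or_ge l.length (n + 1) with hlt | hge
      · exact upqPFiltration_le_succ ρ𝔤 W₀ n (ih.symm ▸ Submodule.subset_span ⟨l, Nat.lt_succ_iff.mp hlt, w, hw, rfl⟩)
      · have hlen : l.length = n + 1 := le_antisymm hl hge
        exact hlen ▸ wordProd_apply_mem_upqPFiltration_length l hw

/-- **SYMMETRISATION** — two words whose letters are a PERMUTATION of each other differ, on `W₀`, by an element of `F_{n−1}` (`n` = the common
length), provided `W₀` is `𝔨`-stable: the multiplication map `𝔭_ℂ^{⊗n} ⊗ W₀ → F_n ∕ F_{n−1}` FACTORS THROUGH `Sym^n(𝔭_ℂ) ⊗ W₀`.  Proof by induction on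
`List.Perm`: an adjacent transposition costs `ρ𝔤([x_s, x_t])` with `[x_s, x_t] ∈ 𝔨` (★ `upq_lie_upqPBasis_mem_kInLie`), which preserves every `F_m` (§3).
[cite: Varadarajan1989, §5.3 (proof of Thm. 10)] [cite: BorelWallach2000, II §1.1 (4)] -/
theorem wordProd_sub_wordProd_apply_mem_of_perm {W₀ : Submodule ℂ V} (hW₀ : ∀ Y ∈ (uFormGroup α β).kInLie, ∀ w ∈ W₀, ρ𝔤 Y w ∈ W₀)
    {l₁ l₂ : List ((α × β) × Fin 2)} (hperm : l₁.Perm l₂) {w : V} (hw : w ∈ W₀) :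
    (l₁.map fun s => ρ𝔤 (upqPBasis s)).prod w - (l₂.map fun s => ρ𝔤 (upqPBasis s)).prod w ∈ upqPFiltration ρ𝔤 W₀ (l₁.length - 1) := by
  induction hperm with
  | nil => simp
  | @cons x l₁ l₂ h ih =>
    simp only [List.map_cons, List.prod_cons, Module.End.mul_apply, List.length_cons, Nat.add_sub_cancel]
    rw [← map_sub]
    rcases Nat.eq_zero_or_pos l₁.length with h0 | hpos
    · obtain rfl : l₁ = [] := List.eq_nil_of_length_eq_zero h0
      obtain rfl : l₂ = [] := List.Perm.nil_eq h |>.symm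
      simp
    · have := apply_upqPBasis_mem_upqPFiltration_succ x ih
      rwa [Nat.sub_add_cancel hpos] at this
  | swap x y l =>
    simp only [List.map_cons, List.prod_cons, Module.End.mul_apply, List.length_cons, Nat.add_sub_cancel]
    have hcomm : ρ𝔤 (upqPBasis y) (ρ𝔤 (upqPBasis x) ((l.map fun s => ρ𝔤 (upqPBasis s)).prod w)) -
        ρ𝔤 (upqPBasis x) (ρ𝔤 (upqPBasis y) ((l.map fun s => ρ𝔤 (upqPBasis s)).prod w)) =
        ρ𝔤 ⁅upqPBasis y, upqPBasis x⁆ ((l.map fun s => ρ𝔤 (upqPBasis s)).prod w) := by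
      rw [LieHom.map_lie, LieRing.of_associative_ring_bracket, LinearMap.sub_apply, Module.End.mul_apply, Module.End.mul_apply]
    rw [hcomm]
    exact upqPFiltration_le_succ ρ𝔤 W₀ _
      (apply_mem_upqPFiltration_of_mem_kInLie hW₀ _ (upq_lie_upqPBasis_mem_kInLie y x) (wordProd_apply_mem_upqPFiltration_length l hw))
  | @trans l₁ l₂ l₃ h₁ h₂ ih₁ ih₂ =>
    have hlen : l₂.length = l₁.length := h₁.length_eq.symm
    rw [hlen] at ih₂
    have := Submodule.add_mem _ ih₁ ih₂
    rwa [sub_add_sub_cancel] at this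

end Filtration

/-! ## §5′ `K`-equivariance of words (any linear real group) -/

section Equivariance

variable {A : Type*} [NormedCommRing A] [NormedAlgebra ℝ A] [NormedAlgebra ℚ A] [CompleteSpace A]
  [StarRing A] [StarModule ℝ A] [ContinuousStar A] {N : Type*} [Fintype N] [DecidableEq N] {G : RealMatrixGroup A N}
  {V : Type*} [AddCommGroup V] [Module ℂ V]
  {ρK : Representation ℂ G.maximalCompact V} {ρ𝔤 : G.lie →ₗ⁅ℝ⁆ Module.End ℂ V}

/-- **`K`-EQUIVARIANCE OF WORDS**: `ρK(k) (ρ𝔤(X₁) ⋯ ρ𝔤(Xₙ) v) = ρ𝔤(Ad k X₁) ⋯ ρ𝔤(Ad k Xₙ) (ρK(k) v)` — the multiplication map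
`𝔤^{⊗n} ⊗ V → V` intertwines `Ad^{⊗n} ⊗ ρK` with `ρK` (★ `IsGKModule.ad_compat`, iterated). [cite: WallachRRG1, §3.3.1] [cite: KnappVogan1995, §I.4 (1.64)] -/
theorem ρK_wordProd_apply (hV : IsGKModule G ρK ρ𝔤) {ι : Type*} (X : ι → G.lie) (k : G.maximalCompact) (l : List ι) (v : V) :
    ρK k ((l.map fun i => ρ𝔤 (X i)).prod v) =
      (l.map fun i => ρ𝔤 (G.Ad (Subgroup.inclusion G.maximalCompact_le_carrier k) (X i))).prod (ρK k v) := by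
  induction l generalizing v with
  | nil => simp
  | cons i l ih =>
    simp only [List.map_cons, List.prod_cons, Module.End.mul_apply]
    have h := LinearMap.congr_fun (hV.ad_compat k (X i)) (ρK k ((l.map fun i => ρ𝔤 (X i)).prod v))
    simp only [LinearMap.coe_comp, Function.comp_apply] at h
    rw [← Module.End.mul_apply (ρK k⁻¹), ← map_mul, inv_mul_cancel, map_one, Module.End.one_apply] at h
    rw [h, ih]

end Equivariance

/-! ## §6 Finite-dimensionality -/

section FiniteDimensional

variable {V : Type*} [AddCommGroup V] [Module ℂ V] {ρ𝔤 : (uFormGroup α β).lie →ₗ⁅ℝ⁆ Module.End ℂ V}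

/-- `𝔭 · U` is finite-dimensional when `U` is (a finite supremum of images). [cite: WallachRRG1, §3.4] -/
theorem finiteDimensional_upqPStep (U : Submodule ℂ V) [FiniteDimensional ℂ U] : FiniteDimensional ℂ (upqPStep ρ𝔤 U) := by
  unfold upqPStep
  infer_instance

/-- **Every `F_n` is finite-dimensional when `W₀` is.** [cite: Varadarajan1989, §5.3 (proof of Thm. 10)] [cite: WallachRRG1, §3.4] -/
theorem finiteDimensional_upqPFiltration (W₀ : Submodule ℂ V) [FiniteDimensional ℂ W₀] (n : ℕ) :
    FiniteDimensional ℂ (upqPFiltration ρ𝔤 W₀ n) := by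
  induction n with
  | zero => exact (inferInstance : FiniteDimensional ℂ W₀)
  | succ n ih =>
    rw [upqPFiltration_succ]
    haveI := ih
    haveI := finiteDimensional_upqPStep (ρ𝔤 := ρ𝔤) (upqPFiltration ρ𝔤 W₀ n)
    infer_instance

end FiniteDimensional

end Literature.NumberTheory.Automorphic

end
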